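import Mathlib

/-!
# Nagata twist for hypersurface frames, I: degree bookkeeping and the Gauss step

Helper file for `stub_dfrTwist` (crux `DefectlessFramesR`, line `Sketch`); its registered sub-goal is
`stub_dfrTwistDegree` (Nagata's trick in the last variable).

Throughout, `A := MvPolynomial (Fin n) k`, `νA := ν.map MvPolynomial.C` for a monic `ν : k[X]` of positive
degree, and the *twisted evaluation*
`Φ := MvPolynomial.aeval (Fin.snoc (fun j => C (X j) - νA ^ N j) X) : k[X_0..X_n] →ₐ[k] A[X]`,
i.e. `X_j ↦ X_j - ν(X_n)^{N j}` for `j < n` and `X_n ↦ X` (the polynomial variable).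
We compute the `X`-degree and leading coefficient of `Φ` of a monomial and of a polynomial whose
monomials have pairwise distinct twisted degrees (Nagata's trick, as in Mathlib's
`RingTheory/NoetherNormalization.lean`, adapted to the last variable and to powers of `ν(X_n)`), prove the
digit arithmetic making the twisted degrees distinct, and record the Gauss-lemma step turning a monic
irreducible relation with non-zero derivative into integrality and separability.
-/

namespace Summit.ResolutionOfSingularities.ResolutionOfSingularities.Theorems

open MvPolynomial Polynomial
open scoped IntermediateField.algebraAdjoinAdjoin

variable {k : Type*} [Field k] {n : ℕ}

/-- One twisted factor `C a - νA ^ m` (`ν` monic of positive degree, `0 < m`): its degree is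
`ν.natDegree * m` and its leading coefficient is `-1`. [folklore] -/
theorem dfrTwist_factor (ν : k[X]) (hν : ν.Monic) (hν1 : 0 < ν.natDegree) (m : ℕ) (hm : 0 < m)
    (a : MvPolynomial (Fin n) k) :
    (Polynomial.C a - (ν.map MvPolynomial.C) ^ m).natDegree
        = ν.natDegree * m ∧
      (Polynomial.C a - (ν.map MvPolynomial.C) ^ m).leadingCoeff = -1 := by
  set q := (ν.map MvPolynomial.C) ^ m with hq
  have hqm : q.Monic := (hν.map _).pow m
  have hqd : q.natDegree = ν.natDegree * m := by
    rw [hq, (hν.map _).natDegree_pow, hν.natDegree_map, mul_comm]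
  have hqpos : 0 < q.natDegree := by rw [hqd]; exact Nat.mul_pos hν1 hm
  have hlt : (Polynomial.C a).natDegree < q.natDegree := by rwa [natDegree_C]
  have hlt' : (Polynomial.C a).degree < q.degree := by
    exact degree_lt_degree (by rwa [natDegree_C])
  have h1 : (q - Polynomial.C a).Monic := hqm.sub_of_left hlt'
  have h2 : (q - Polynomial.C a).natDegree = q.natDegree := natDegree_sub_eq_left_of_natDegree_lt hlt
  rw [show Polynomial.C a - q = -(q - Polynomial.C a) by ring, natDegree_neg, leadingCoeff_neg,
    h1.leadingCoeff, h2, hqd]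
  exact ⟨rfl, rfl⟩

/-- The twisted evaluation of a monomial, as a product. [folklore] -/
theorem dfrTwist_aeval_monomial (ν : k[X]) (N : Fin n → ℕ) (α : Fin (n + 1) →₀ ℕ) (a : k) :
    MvPolynomial.aeval (Fin.snoc (fun j => Polynomial.C (X j) -
        (ν.map MvPolynomial.C) ^ N j) Polynomial.X) (monomial α a)
      = Polynomial.C (MvPolynomial.C a) * (∏ j : Fin n, (Polynomial.C (X j) -
        (ν.map MvPolynomial.C) ^ N j) ^ α (Fin.castSucc j)) *
          Polynomial.X ^ α (Fin.last n) := by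
  rw [MvPolynomial.aeval_monomial, Finsupp.prod_fintype _ _ (fun i => pow_zero _),
    Fin.prod_univ_castSucc]
  simp only [Fin.snoc_castSucc, Fin.snoc_last, Polynomial.algebraMap_apply, MvPolynomial.algebraMap_eq,
    mul_assoc]

/-- Degree and leading coefficient of the twisted evaluation of a monomial `a • X^α`, `a ≠ 0`:
the degree is `ν.natDegree * (∑ j, N j * α j) + α n` and the leading coefficient is a unit.
[folklore] -/
theorem dfrTwist_natDegree_monomial (ν : k[X]) (hν : ν.Monic) (hν1 : 0 < ν.natDegree)
    (N : Fin n → ℕ) (hN : ∀ j, 0 < N j) (α : Fin (n + 1) →₀ ℕ) (a : k) (ha : a ≠ 0) :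
    (MvPolynomial.aeval (Fin.snoc (fun j => Polynomial.C (X j) -
        (ν.map MvPolynomial.C) ^ N j) Polynomial.X)
          (monomial α a)).natDegree
        = ν.natDegree * (∑ j : Fin n, N j * α (Fin.castSucc j)) + α (Fin.last n) ∧
      IsUnit (MvPolynomial.aeval (Fin.snoc (fun j => Polynomial.C (X j) -
        (ν.map MvPolynomial.C) ^ N j) Polynomial.X)
          (monomial α a)).leadingCoeff := by
  rw [dfrTwist_aeval_monomial]
  set L : Fin n → (MvPolynomial (Fin n) k)[X] := fun j => Polynomial.C (X j) -
    (ν.map MvPolynomial.C) ^ N j with hL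
  have hLj : ∀ j, (L j).natDegree = ν.natDegree * N j ∧ (L j).leadingCoeff = -1 := fun j =>
    dfrTwist_factor ν hν hν1 (N j) (hN j) (X j)
  have hLne : ∀ j, L j ≠ 0 := fun j h => by
    have := (hLj j).2
    rw [h, leadingCoeff_zero] at this
    exact one_ne_zero (neg_eq_zero.mp this.symm)
  have hCa : (Polynomial.C (MvPolynomial.C a : MvPolynomial (Fin n) k)) ≠ 0 := by
    simpa using ha
  have hprod : (∏ j : Fin n, L j ^ α (Fin.castSucc j)) ≠ 0 :=
    Finset.prod_ne_zero_iff.mpr fun j _ => pow_ne_zero _ (hLne j)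
  have hXp : (Polynomial.X : (MvPolynomial (Fin n) k)[X]) ^ α (Fin.last n) ≠ 0 := pow_ne_zero _ X_ne_zero
  refine ⟨?_, ?_⟩
  · rw [natDegree_mul (mul_ne_zero hCa hprod) hXp, natDegree_mul hCa hprod, natDegree_C, zero_add,
      natDegree_X_pow, natDegree_prod _ _ (fun j _ => pow_ne_zero _ (hLne j)), Finset.mul_sum]
    congr 1
    refine Finset.sum_congr rfl fun j _ => ?_
    rw [natDegree_pow, (hLj j).1]; ring
  · rw [leadingCoeff_mul, leadingCoeff_mul, leadingCoeff_C, leadingCoeff_X_pow, mul_one,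
      leadingCoeff_prod]
    have : (∏ j : Fin n, (L j ^ α (Fin.castSucc j)).leadingCoeff)
        = (-1) ^ (∑ j : Fin n, α (Fin.castSucc j)) := by
      rw [← Finset.prod_pow_eq_pow_sum]
      exact Finset.prod_congr rfl fun j _ => by rw [leadingCoeff_pow, (hLj j).2]
    rw [this]
    exact ((isUnit_iff_ne_zero.mpr ha).map MvPolynomial.C).mul (isUnit_one.neg.pow _)

/-- Nagata's trick in the last variable: if the twisted degrees
`ν.natDegree * (∑ j, N j * α j) + α n` are pairwise distinct on the support of `f ≠ 0`, then the
twisted evaluation of `f` has the maximal twisted degree and a unit leading coefficient. [folklore] -/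
theorem dfrTwist_leadingCoeff_of_injOn (ν : k[X]) (hν : ν.Monic) (hν1 : 0 < ν.natDegree)
    (N : Fin n → ℕ) (hN : ∀ j, 0 < N j) (f : MvPolynomial (Fin (n + 1)) k) (hf : f ≠ 0)
    (hinj : ∀ α ∈ f.support, ∀ β ∈ f.support,
      ν.natDegree * (∑ j : Fin n, N j * α (Fin.castSucc j)) + α (Fin.last n)
        = ν.natDegree * (∑ j : Fin n, N j * β (Fin.castSucc j)) + β (Fin.last n) → α = β) :
    ∃ α ∈ f.support,
      (MvPolynomial.aeval (Fin.snoc (fun j => Polynomial.C (X j) -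
        (ν.map MvPolynomial.C) ^ N j) Polynomial.X) f).natDegree
          = ν.natDegree * (∑ j : Fin n, N j * α (Fin.castSucc j)) + α (Fin.last n) ∧
      IsUnit (MvPolynomial.aeval (Fin.snoc (fun j => Polynomial.C (X j) -
        (ν.map MvPolynomial.C) ^ N j) Polynomial.X) f).leadingCoeff ∧
      ∀ β ∈ f.support, ν.natDegree * (∑ j : Fin n, N j * β (Fin.castSucc j)) + β (Fin.last n)
        ≤ ν.natDegree * (∑ j : Fin n, N j * α (Fin.castSucc j)) + α (Fin.last n) := by
  classical
  set Φ : MvPolynomial (Fin (n + 1)) k →ₐ[k] (MvPolynomial (Fin n) k)[X] :=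
    MvPolynomial.aeval (Fin.snoc (fun j => Polynomial.C (X j) -
      (ν.map MvPolynomial.C) ^ N j) Polynomial.X) with hΦ
  set D : (Fin (n + 1) →₀ ℕ) → ℕ := fun α =>
    ν.natDegree * (∑ j : Fin n, N j * α (Fin.castSucc j)) + α (Fin.last n) with hD
  obtain ⟨α, hα, hmax⟩ := Finset.exists_max_image f.support D (support_nonempty.mpr hf)
  refine ⟨α, hα, ?_⟩
  have hmono : ∀ β ∈ f.support, (Φ (monomial β (coeff β f))).natDegree = D β ∧
      IsUnit (Φ (monomial β (coeff β f))).leadingCoeff := fun β hβ =>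
    dfrTwist_natDegree_monomial ν hν hν1 N hN β _ (mem_support_iff.mp hβ)
  have hne : Φ (monomial α (coeff α f)) ≠ 0 := fun h => by
    have := (hmono α hα).2
    rw [h, leadingCoeff_zero] at this
    exact not_isUnit_zero this
  have hlt : ∀ β ∈ f.support \ {α},
      (Φ (monomial β (coeff β f))).degree < (Φ (monomial α (coeff α f))).degree := by
    intro β hβ
    obtain ⟨hβ, hβα⟩ := Finset.mem_sdiff.mp hβ
    have hβα : β ≠ α := fun h => hβα (Finset.mem_singleton.mpr h)
    rw [degree_eq_natDegree hne, (hmono α hα).1]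
    by_cases hz : Φ (monomial β (coeff β f)) = 0
    · rw [hz, degree_zero]; exact WithBot.bot_lt_coe _
    rw [degree_eq_natDegree hz, (hmono β hβ).1, Nat.cast_lt]
    exact lt_of_le_of_ne (hmax β hβ) (fun h => hβα (hinj β hβ α hα h))
  have hsum : (∑ β ∈ f.support \ {α}, Φ (monomial β (coeff β f))).degree
      < (Φ (monomial α (coeff α f))).degree :=
    lt_of_le_of_lt (degree_sum_le _ _)
      ((Finset.sup_lt_iff (Ne.bot_lt (fun h => hne (degree_eq_bot.mp h)))).mpr hlt)
  have hΦf : Φ f = Φ (monomial α (coeff α f)) + ∑ β ∈ f.support \ {α}, Φ (monomial β (coeff β f)) := by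
    rw [← map_sum, ← map_add]
    congr 1
    conv_lhs => rw [← support_sum_monomial_coeff f]
    exact Finset.sum_eq_add_sum_sdiff_singleton_of_mem hα (fun β => monomial β (coeff β f))
  rw [hΦf, natDegree_add_eq_left_of_degree_lt hsum, leadingCoeff_add_of_degree_lt' hsum]
  exact ⟨(hmono α hα).1, (hmono α hα).2, hmax⟩

/-- A nonzero exponent has positive twisted degree. [folklore] -/
theorem dfrTwist_twistedDegree_pos (d₀ : ℕ) (hd₀ : 0 < d₀) (N : Fin n → ℕ) (hN : ∀ j, 0 < N j)
    (α : Fin (n + 1) →₀ ℕ) (hα : α ≠ 0) :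
    0 < d₀ * (∑ j : Fin n, N j * α (Fin.castSucc j)) + α (Fin.last n) := by
  refine Nat.pos_of_ne_zero fun h0 => hα ?_
  have hlast : α (Fin.last n) = 0 := by omega
  have hsum : ∑ j : Fin n, N j * α (Fin.castSucc j) = 0 := by
    have : d₀ * (∑ j : Fin n, N j * α (Fin.castSucc j)) = 0 := by omega
    exact (Nat.mul_eq_zero.mp this).resolve_left (Nat.pos_iff_ne_zero.mp hd₀)
  ext i
  induction i using Fin.lastCases with
  | last => simpa using hlast
  | cast j =>
    have := (Finset.sum_eq_zero_iff.mp hsum) j (Finset.mem_univ _)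
    simpa [Nat.pos_iff_ne_zero.mp (hN j)] using this

/-- Base-`M` digits are unique: `∑ j, v j * M ^ j` determines `v` when all `v j < M`. [folklore] -/
theorem dfrTwist_digits_inj (M : ℕ) : ∀ (m : ℕ) (v w : Fin m → ℕ), (∀ j, v j < M) → (∀ j, w j < M) →
    ∑ j : Fin m, v j * M ^ (j : ℕ) = ∑ j : Fin m, w j * M ^ (j : ℕ) → v = w := by
  intro m
  induction m with
  | zero => intro v w _ _ _; exact funext fun j => j.elim0
  | succ m ih =>
    intro v w hv hw h
    have hM : 0 < M := lt_of_le_of_lt (Nat.zero_le _) (hv 0)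
    have key : ∀ u : Fin (m + 1) → ℕ, ∑ j : Fin (m + 1), u j * M ^ (j : ℕ)
        = M * (∑ j : Fin m, u (Fin.succ j) * M ^ (j : ℕ)) + u 0 := by
      intro u
      rw [Fin.sum_univ_succ, Finset.mul_sum, add_comm]
      simp only [Fin.val_zero, pow_zero, mul_one, Fin.val_succ, pow_succ]
      exact congrArg (· + u 0) (Finset.sum_congr rfl fun j _ => by ring)
    rw [key v, key w] at h
    have h0 : v 0 = w 0 := by
      have := congrArg (fun x => x % M) h
      simpa [Nat.mul_add_mod, Nat.mod_eq_of_lt (hv 0), Nat.mod_eq_of_lt (hw 0)] using this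
    have h1 : ∑ j : Fin m, v (Fin.succ j) * M ^ (j : ℕ) = ∑ j : Fin m, w (Fin.succ j) * M ^ (j : ℕ) := by
      have := congrArg (fun x => x / M) h
      simpa [Nat.mul_add_div hM, Nat.div_eq_of_lt (hv 0), Nat.div_eq_of_lt (hw 0)] using this
    have htail := ih (fun j => v j.succ) (fun j => w j.succ) (fun j => hv _) (fun j => hw _) h1
    funext i
    refine Fin.cases h0 (fun j => ?_) i
    exact congrFun htail j

/-- The indicator sum `∑ j, [t = some j] * γ j` is at most one coordinate of `γ`; together with the
last coordinate it is bounded by the total degree. [folklore] -/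
theorem dfrTwist_indicator_sum_le (t : Option (Fin n)) (γ : Fin (n + 1) →₀ ℕ) :
    (∑ j : Fin n, (if t = some j then 1 else 0) * γ (Fin.castSucc j)) + γ (Fin.last n)
      ≤ ∑ i : Fin (n + 1), γ i := by
  rw [Fin.sum_univ_castSucc]
  refine Nat.add_le_add_right ?_ _
  cases t with
  | none => simp
  | some j0 =>
    simp only [Option.some.injEq, ite_mul, one_mul, zero_mul, Finset.sum_ite_eq, Finset.mem_univ,
      if_true]
    exact Finset.single_le_sum (f := fun j => γ (Fin.castSucc j)) (fun i _ => Nat.zero_le _)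
      (Finset.mem_univ j0)

/-- Injectivity of the twisted degree for Nagata exponents `N j = M^(j+1) + [t = some j]`
on exponents of total degree `≤ d < M`. [folklore] -/
theorem dfrTwist_twistedDegree_inj (d₀ M d : ℕ) (hd₀ : 0 < d₀) (hdM : d < M) (t : Option (Fin n))
    (α β : Fin (n + 1) →₀ ℕ) (hα : ∑ i, α i ≤ d) (hβ : ∑ i, β i ≤ d)
    (h : d₀ * (∑ j : Fin n, (M ^ ((j : ℕ) + 1) + if t = some j then 1 else 0) * α (Fin.castSucc j))
          + α (Fin.last n)
        = d₀ * (∑ j : Fin n, (M ^ ((j : ℕ) + 1) + if t = some j then 1 else 0) * β (Fin.castSucc j))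
          + β (Fin.last n)) :
    α = β := by
  -- abbreviations
  set S : (Fin (n + 1) →₀ ℕ) → ℕ := fun γ => ∑ j : Fin n, γ (Fin.castSucc j) * M ^ (j : ℕ) with hS
  set r : (Fin (n + 1) →₀ ℕ) → ℕ := fun γ =>
    d₀ * (∑ j : Fin n, (if t = some j then 1 else 0) * γ (Fin.castSucc j)) + γ (Fin.last n) with hr
  have expand : ∀ γ : Fin (n + 1) →₀ ℕ,
      d₀ * (∑ j : Fin n, (M ^ ((j : ℕ) + 1) + if t = some j then 1 else 0) * γ (Fin.castSucc j))
        + γ (Fin.last n) = (d₀ * M) * S γ + r γ := by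
    intro γ
    have e1 : ∑ j : Fin n, M ^ ((j : ℕ) + 1) * γ (Fin.castSucc j) = M * S γ := by
      rw [hS, Finset.mul_sum]
      exact Finset.sum_congr rfl fun j _ => by ring
    simp only [add_mul, Finset.sum_add_distrib, e1, hr]
    ring
  have hbound : ∀ γ : Fin (n + 1) →₀ ℕ, ∑ i, γ i ≤ d → r γ < d₀ * M := by
    intro γ hγ
    have h1 := (dfrTwist_indicator_sum_le t γ).trans hγ
    have h2 : r γ ≤ d₀ * ((∑ j : Fin n, (if t = some j then 1 else 0) * γ (Fin.castSucc j))
        + γ (Fin.last n)) := by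
      rw [hr, mul_add]
      exact Nat.add_le_add_left (Nat.le_mul_of_pos_left _ hd₀) _
    exact lt_of_le_of_lt (h2.trans (Nat.mul_le_mul_left _ h1)) (Nat.mul_lt_mul_of_pos_left hdM hd₀)
  rw [expand α, expand β] at h
  have hpos : 0 < d₀ * M := Nat.mul_pos hd₀ (lt_of_le_of_lt (Nat.zero_le _) hdM)
  have hSS : S α = S β := by
    have := congrArg (fun x => x / (d₀ * M)) h
    simpa [Nat.mul_add_div hpos, Nat.div_eq_of_lt (hbound α hα), Nat.div_eq_of_lt (hbound β hβ)]
      using this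
  have hrr : r α = r β := by
    have := congrArg (fun x => x % (d₀ * M)) h
    simpa [Nat.mul_add_mod, Nat.mod_eq_of_lt (hbound α hα), Nat.mod_eq_of_lt (hbound β hβ)]
      using this
  have hlt : ∀ γ : Fin (n + 1) →₀ ℕ, ∑ i, γ i ≤ d → ∀ j : Fin n, γ (Fin.castSucc j) < M :=
    fun γ hγ j => lt_of_le_of_lt ((Finset.single_le_sum (f := fun i => γ i) (fun i _ => Nat.zero_le _)
      (Finset.mem_univ _)).trans hγ) hdM
  have hcs : (fun j : Fin n => α (Fin.castSucc j)) = fun j => β (Fin.castSucc j) :=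
    dfrTwist_digits_inj M n _ _ (hlt α hα) (hlt β hβ) hSS
  have hlast : α (Fin.last n) = β (Fin.last n) := by
    have ht : (∑ j : Fin n, (if t = some j then 1 else 0) * α (Fin.castSucc j))
        = ∑ j : Fin n, (if t = some j then 1 else 0) * β (Fin.castSucc j) :=
      Finset.sum_congr rfl fun j _ => by rw [congrFun hcs j]
    simp only [hr, ht] at hrr
    omega
  ext i
  induction i using Fin.lastCases with
  | last => exact hlast
  | cast j => exact congrFun hcs j

/-- If a non-zero polynomial takes a value in the maximal ideal of a local ring, so does one of its
monic irreducible factors. [folklore] -/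
theorem dfrTwist_exists_irreducible_eval₂_mem {k R : Type*} [Field k] [CommRing R] [IsLocalRing R]
    (ι : k →+* R) (z : R) (g : k[X]) (hg : g ≠ 0)
    (hgz : g.eval₂ ι z ∈ IsLocalRing.maximalIdeal R) :
    ∃ ν : k[X], Irreducible ν ∧ ν.Monic ∧ ν.eval₂ ι z ∈ IsLocalRing.maximalIdeal R := by
  induction g using WfDvdMonoid.induction_on_irreducible with
  | zero => exact absurd rfl hg
  | unit u hu =>
    obtain ⟨c, hc, rfl⟩ := Polynomial.isUnit_iff.mp hu
    rw [Polynomial.eval₂_C] at hgz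
    exact absurd (hc.map ι) ((IsLocalRing.mem_maximalIdeal _).mp hgz)
  | mul a q ha hq ih =>
    rw [Polynomial.eval₂_mul] at hgz
    rcases (IsLocalRing.maximalIdeal.isMaximal R).isPrime.mem_or_mem hgz with h | h
    · refine ⟨q * Polynomial.C (q.leadingCoeff)⁻¹, ?_, monic_mul_leadingCoeff_inv hq.ne_zero, ?_⟩
      · rwa [irreducible_mul_leadingCoeff_inv]
      · rw [Polynomial.eval₂_mul, Polynomial.eval₂_C]
        exact Ideal.mul_mem_right _ _ h
    · exact ih ha h

/-- A separable polynomial of positive degree has non-zero derivative. [folklore] -/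
theorem dfrTwist_derivative_ne_zero_of_separable {k : Type*} [Field k] (ν : k[X]) (hsep : ν.Separable)
    (hdeg : 0 < ν.natDegree) : derivative ν ≠ 0 := by
  intro h
  have hu : IsUnit ν := by
    have : IsCoprime ν (derivative ν) := hsep
    rw [h] at this
    exact isCoprime_zero_right.mp this
  have := natDegree_eq_zero_of_isUnit hu
  omega

/-- Evaluation inside a subring agrees with evaluation in the field. [folklore] -/
theorem dfrTwist_coe_eval₂ {k K : Type*} [Field k] [Field K] [Algebra k K] (O : ValuationSubring K)
    (hk : ∀ c : k, algebraMap k K c ∈ O) (z : O) (g : k[X]) :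
    ((g.eval₂ ((algebraMap k K).codRestrict O hk) z : O) : K) = Polynomial.aeval (z : K) g := by
  rw [Polynomial.aeval_def, show ((g.eval₂ ((algebraMap k K).codRestrict O hk) z : O) : K)
      = O.subtype (g.eval₂ ((algebraMap k K).codRestrict O hk) z) from rfl, Polynomial.hom_eval₂]
  rfl

/-- Gauss-lemma step. Let `x : Fin n → K` be algebraically independent over `k` and `F₁ ∈ A[X]`
(`A = k[X_0..X_{n-1}]`) monic, irreducible, with non-zero derivative, vanishing at `(x, z)`. Then `z`
is integral over `k[x]` and separable over `k(x)`. [folklore] -/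
theorem dfrTwist_isIntegral_isSeparable {k K : Type*} [Field k] [Field K] [Algebra k K] {n : ℕ}
    (x : Fin n → K) (hx : AlgebraicIndependent k x) (F₁ : (MvPolynomial (Fin n) k)[X])
    (hmon : F₁.Monic) (hirr : Irreducible F₁) (hder : derivative F₁ ≠ 0) (z : K)
    (hz : F₁.eval₂ (MvPolynomial.aeval x : MvPolynomial (Fin n) k →ₐ[k] K).toRingHom z = 0) :
    IsIntegral (Algebra.adjoin k (Set.range x)) z ∧
      IsSeparable (IntermediateField.adjoin k (Set.range x)) z := by
  set B := Algebra.adjoin k (Set.range x) with hB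
  set F' := IntermediateField.adjoin k (Set.range x) with hF'
  let eB : MvPolynomial (Fin n) k ≃ₐ[k] B := hx.aevalEquiv
  haveI : UniqueFactorizationMonoid B := eB.toMulEquiv.uniqueFactorizationMonoid inferInstance
  set ψ : MvPolynomial (Fin n) k →+* B := eB.toRingEquiv.toRingHom with hψ
  have hψinj : Function.Injective ψ := eB.injective
  have hψK : (algebraMap B K).comp ψ = (MvPolynomial.aeval x : MvPolynomial (Fin n) k →ₐ[k] K).toRingHom :=
    RingHom.ext fun g => hx.algebraMap_aevalEquiv g
  set G₁ : B[X] := F₁.map ψ with hG₁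
  have hG₁mon : G₁.Monic := hmon.map ψ
  have hG₁irr : Irreducible G₁ :=
    (MulEquiv.irreducible_iff (Polynomial.mapEquiv eB.toRingEquiv)).mpr hirr
  have hG₁z : Polynomial.aeval z G₁ = 0 := by
    rw [Polynomial.aeval_def, hG₁, Polynomial.eval₂_map, hψK, hz]
  have hint : IsIntegral B z := ⟨G₁, hG₁mon, by rwa [Polynomial.aeval_def] at hG₁z⟩
  refine ⟨hint, ?_⟩
  have hG₁F' : Irreducible (G₁.map (algebraMap B F')) :=
    (hG₁mon.irreducible_iff_irreducible_map_fraction_map).mp hG₁irr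
  have hmin : G₁.map (algebraMap B F') = minpoly F' z :=
    minpoly.eq_of_irreducible_of_monic hG₁F' (by rw [Polynomial.aeval_map_algebraMap, hG₁z])
      (hG₁mon.map _)
  show (minpoly F' z).Separable
  rw [← hmin, Polynomial.separable_iff_derivative_ne_zero hG₁F', derivative_map, Ne,
    Polynomial.map_eq_zero_iff (FaithfulSMul.algebraMap_injective B F'), hG₁, derivative_map,
    Polynomial.map_eq_zero_iff hψinj]
  exact hder

/-- Registered sub-goal of `stub_dfrTwist`: **Nagata's trick in the last variable**. If the twisted degrees
`ν.natDegree * (∑ j, N j * α j) + α n` are pairwise distinct on the support of `f ≠ 0`, then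
`f(X_0 - ν(X)^{N_0}, …, X_{n-1} - ν(X)^{N_{n-1}}, X) ∈ A[X]` has the maximal twisted degree as `X`-degree and a
unit of `A = k[X_0..X_{n-1}]` as leading coefficient. [folklore] -/
theorem stub_dfrTwistDegree : ∀ (k : Type) [Field k] (n : ℕ) (ν : Polynomial k) (N : Fin n → ℕ) (f : MvPolynomial (Fin (n + 1)) k), ν.Monic → 0 < ν.natDegree → (∀ j, 0 < N j) → f ≠ 0 → (∀ α ∈ f.support, ∀ β ∈ f.support, ν.natDegree * (∑ j : Fin n, N j * α (Fin.castSucc j)) + α (Fin.last n) = ν.natDegree * (∑ j : Fin n, N j * β (Fin.castSucc j)) + β (Fin.last n) → α = β) → ∃ α ∈ f.support, (MvPolynomial.aeval (Fin.snoc (fun j => Polynomial.C (MvPolynomial.X j) - (ν.map MvPolynomial.C) ^ N j) Polynomial.X) f).natDegree = ν.natDegree * (∑ j : Fin n, N j * α (Fin.castSucc j)) + α (Fin.last n) ∧ IsUnit (MvPolynomial.aeval (Fin.snoc (fun j => Polynomial.C (MvPolynomial.X j) - (ν.map MvPolynomial.C) ^ N j) Polynomial.X) f).leadingCoeff := by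
  intro k _ n ν N f hν hν1 hN hf hinj
  obtain ⟨α, hα, h1, h2, _⟩ := dfrTwist_leadingCoeff_of_injOn ν hν hν1 N hN f hf hinj
  exact ⟨α, hα, h1, h2⟩

end Summit.ResolutionOfSingularities.ResolutionOfSingularities.Theorems
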